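import Literature.AnabelianGeometry.AbsoluteAnabelian.ArchimedeanHolFieldFunctorGeometric
import Literature.AnabelianGeometry.AbsoluteAnabelian.AutHolFieldFunctorNonVacuity
import HarnessLib

/-!
# [AbsTopIII] Def 4.1 (v) — `LinHolObj` over the GEOMETRIC functor (row «NV-L4/LinHolObj», genuine instance)

Mochizuki, *Topics in Absolute Anabelian Geometry III*, Def 4.1 (i) p. 101, (iii) p. 103, (v) p. 105. PROOF-ONLY
companion (no `def`, no `instance`, no `structure`), per abc-iut-L4-lead 05:01:08Z «LinHolObj: GO-CONDITIONAL — build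
it OVER `HolRS.geometricAutHolFieldFunctor`, not over a degenerate EA»: abc-iut-L4-t14's GENUINE instance
`HolRS.geometricAutHolFieldFunctor Q` (p422524; `EA :=` the full subcategory `Q` of the category `HolRS` of connected Riemann
surfaces with holomorphic finite étale maps, `𝒜_𝕏 := ℂ` = the multiplier field of the germ model, Cor 2.7 (e) /
Prop 2.6 (a)) combined with the generic criterion `LinHolObj.nonempty_iff` (p423848): the objects `(𝕏 ↶ 𝒜_𝕏)` of
`LinHol` exist over the geometric functor as soon as `Q` admits an object — in particular with no restriction
(`Q = ⊤`, the complex plane, L4-t14's `nonempty_EA_top`). HONEST LABEL: genuine RELATIVE TO L4-t14's geometric model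
(whose own scope — holomorphic maps only, `𝒜_φ = id`, `Q` a parameter standing for "elliptically admissible" — is
stated in its file); nothing of [AbsTopIII] is asserted. [cite: MochizukiAbsTopIII2015, Definition 4.1 (v) p.105]
-/

noncomputable section

namespace Literature.AnabelianGeometry.AbsoluteAnabelian

open _root_.CategoryTheory

/-- **AbsTopIII:Def4.1(v)** (kurims p.105) Over the GEOMETRIC functor `HolRS.geometricAutHolFieldFunctor Q` (abc-iut-L4-t14):
every connected Riemann surface `X` with `Q X` gives an object `(𝕏 ↶ 𝒜_𝕏)` of `LinHol` (the tautological pair,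
`𝒜_𝕏 = ℂ`). [cite: MochizukiAbsTopIII2015, Definition 4.1 (v) p.105] -/
theorem LinHolObj.exists_geometric (Q : ObjectProperty HolRS) (X : HolRS) (hX : Q X) :
    ∃ P : LinHolObj (HolRS.geometricAutHolFieldFunctor Q),
      P.X = (⟨X, hX⟩ : (HolRS.geometricAutHolFieldFunctor Q).EA) :=
  LinHolObj.exists_of_obj (HolRS.geometricAutHolFieldFunctor Q) (⟨X, hX⟩ : (HolRS.geometricAutHolFieldFunctor Q).EA)

/-- **AbsTopIII:Def4.1(v)** (kurims p.105) `LinHolObj` over the geometric functor is inhabited iff `Q` admits an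
object (generic criterion `LinHolObj.nonempty_iff` at the genuine instance). [cite: MochizukiAbsTopIII2015, Definition 4.1 (v) p.105] -/
theorem LinHolObj.nonempty_geometric_iff (Q : ObjectProperty HolRS) :
    Nonempty (LinHolObj (HolRS.geometricAutHolFieldFunctor Q)) ↔ ∃ X : HolRS, Q X :=
  (LinHolObj.nonempty_iff _).trans ⟨fun ⟨⟨X, hX⟩⟩ => ⟨X, hX⟩, fun ⟨X, hX⟩ => ⟨⟨X, hX⟩⟩⟩

/-- **AbsTopIII:Def4.1(v)** (kurims p.105) GENUINE closed term: with no restriction on the objects (`Q = ⊤`), the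
complex plane (L4-t14's `HolRS.complexPlane`, `HolRS.nonempty_EA_top`) carries a `LinHol`-object.
[cite: MochizukiAbsTopIII2015, Definition 4.1 (v) p.105] -/
theorem LinHolObj.nonempty_geometric_top : Nonempty (LinHolObj (HolRS.geometricAutHolFieldFunctor ⊤)) :=
  (LinHolObj.nonempty_iff _).2 HolRS.nonempty_EA_top

end Literature.AnabelianGeometry.AbsoluteAnabelian

end
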